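import Mathlib

/-!
# Reduction modulo an inert prime for quadratic units: `rank U(θ) = |𝒜|` over a finite field certifies a whole unit class (LEMMA R_p)

Helper file for crux `stmt-CriticalPhenomena-4575` (`NoHeavyLowerTail`, route `PercNearOneGluingNoHeavy`), new-inequality factory
seat `prim-ineq-gen-3` (gen 28).  Everything here is PROVED; no definitions.  Companion of `…OrderedDifferencesGoldenCharTwo`
(the golden ratio at `p = 2`); here the quadratic relation `t² = u t + v` and the modulus `p` are parameters.

Notation (memo `run/shared/lean/prim/prim-ineq-gen-3/CONJECTURE-P2F2.md`): the PENCIL rows of a finite family `𝒜` at `t` are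
`A ↦ (E ↦ [E ⊆ A] + t [E ∩ A = ∅])` over the difference family `E ∈ 𝒜 \\ 𝒜`.

* `quad_mul_expand` — `(x + y t)(z + t w) = (x z + v y w) + (x w + y z + u y w) t` when `t² = u t + v`.
* `exists_reduced_dependency_of_integral_dependency` — ★ let `t² = u t + v` in a field `K` in which `1, t` are independent over `ℤ`,
  and `θ² = u θ + v` in a field `F` in which `a + b θ = 0` (`a b : ℤ`) forces `p ∣ a, p ∣ b` (`p ≥ 2` an integer: 'θ generates the
  residue field extension', e.g. `F ⊇ 𝔽_{p²}` with `θ ∉ 𝔽_p`).  If `A ↦ a_A + b_A t` (integer vectors, not both zero) is a dependency of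
  the pencil at `t`, then the pencil at `θ` has a non-zero dependency over `F` [split along `{1, t}` into two integer identities per
  column; divide `(a, b)` by `p` while possible (descent on `∑ |a_A| + |b_A|`); reduce: `A ↦ ā_A + b̄_A θ`].
* `exists_int_add_int_mul_of_mem_adjoin_quad` — `ℤ[t] = ℤ + ℤ t`.
* `linearIndependent_pencil_quad_of_reduction` — ★★ LEMMA R_p for quadratic units: under the same hypotheses, if the pencil rows of
  `𝒜` at `θ` are independent over `F` then the pencil rows at `t` are independent over `K` [a dependency over `K` descends to
  `ℤ[t]` by `linearIndependent_algebraMap_comp_iff`].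
* `linearIndependent_pencil_golden_of_charThree` — ★ instance: `F` of characteristic `3` with `θ² = θ + 1` (`𝔽₉ ⊆ F`), `K` of
  characteristic `0` with `t² = t + 1`: independence at `θ` implies independence at the golden ratio.  (With `…GoldenCharTwo` the golden
  class has two independent finite certificates, `rank_{𝔽₄} U(ω)` and `rank_{𝔽₉} U(θ)`.)
(prim-ineq-gen-3 gen 28, 2026-08-25.)
-/

namespace Summit.CriticalPhenomena.PercolationContinuityZ3.Theorems

namespace OrderedDifferences

open Finset
open scoped FinsetFamily

variable {α : Type*} [DecidableEq α]

/-- The algebra behind the reductions: `(x + y t)(z + t w) = (x z + v y w) + (x w + y z + u y w) t` whenever `t * t = u * t + v`. -/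
theorem quad_mul_expand {R : Type*} [CommRing R] {t u v : R} (ht : t * t = u * t + v) (x y z w : R) :
    (x + y * t) * (z + t * w) = (x * z + v * (y * w)) + (x * w + y * z + u * (y * w)) * t := by
  linear_combination (y * w) * ht

/-- **Integral dependency at `t` ⟹ dependency at the reduction `θ`.**  See the module doc-string. -/
theorem exists_reduced_dependency_of_integral_dependency (𝒜 : Finset (Finset α)) (u v : ℤ) {p : ℕ} (hp : 1 < p)
    {K : Type*} [Field K] {t : K} (ht : t * t = (u : K) * t + (v : K))
    (hK : ∀ a b : ℤ, (a : K) + (b : K) * t = 0 → a = 0 ∧ b = 0)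
    {F : Type*} [Field F] {θ : F} (hθ : θ * θ = (u : F) * θ + (v : F))
    (hF : ∀ a b : ℤ, (a : F) + (b : F) * θ = 0 → (p : ℤ) ∣ a ∧ (p : ℤ) ∣ b)
    (a b : ↥𝒜 → ℤ) (hab : ∃ A, a A ≠ 0 ∨ b A ≠ 0)
    (hdep : ∀ E ∈ 𝒜 \\ 𝒜, ∑ A : 𝒜, ((a A : K) + (b A : K) * t) *
        ((if E ⊆ (A : Finset α) then (1 : K) else 0) + t * (if Disjoint E (A : Finset α) then (1 : K) else 0)) = 0) :
    ∃ w : ↥𝒜 → F, w ≠ 0 ∧ ∀ E ∈ 𝒜 \\ 𝒜, ∑ A : 𝒜, w A *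
        ((if E ⊆ (A : Finset α) then (1 : F) else 0) + θ * (if Disjoint E (A : Finset α) then (1 : F) else 0)) = 0 := by
  classical
  let zI : ↥𝒜 → Finset α → ℤ := fun A E => if E ⊆ (A : Finset α) then 1 else 0
  let yI : ↥𝒜 → Finset α → ℤ := fun A E => if Disjoint E (A : Finset α) then 1 else 0
  -- the two integer identities per column
  have hPQ : ∀ E ∈ 𝒜 \\ 𝒜, (∑ A : 𝒜, (a A * zI A E + v * (b A * yI A E)) = 0) ∧
      (∑ A : 𝒜, (a A * yI A E + b A * zI A E + u * (b A * yI A E)) = 0) := by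
    intro E hE
    have h := hdep E hE
    have e : ∑ A : 𝒜, ((a A : K) + (b A : K) * t) *
        ((if E ⊆ (A : Finset α) then (1 : K) else 0) + t * (if Disjoint E (A : Finset α) then (1 : K) else 0)) =
        ((∑ A : 𝒜, (a A * zI A E + v * (b A * yI A E)) : ℤ) : K) +
          ((∑ A : 𝒜, (a A * yI A E + b A * zI A E + u * (b A * yI A E)) : ℤ) : K) * t := by
      push_cast [zI, yI]
      rw [sum_mul, ← sum_add_distrib]
      refine sum_congr rfl fun A _ => ?_
      rw [quad_mul_expand ht]
    rw [e] at h
    exact hK _ _ h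
  -- descent on the integer data
  suffices H : ∀ (n : ℕ) (a b : ↥𝒜 → ℤ), ∑ A : 𝒜, ((a A).natAbs + (b A).natAbs) ≤ n → (∃ A, a A ≠ 0 ∨ b A ≠ 0) →
      (∀ E ∈ 𝒜 \\ 𝒜, (∑ A : 𝒜, (a A * zI A E + v * (b A * yI A E)) = 0) ∧
        (∑ A : 𝒜, (a A * yI A E + b A * zI A E + u * (b A * yI A E)) = 0)) →
      ∃ w : ↥𝒜 → F, w ≠ 0 ∧ ∀ E ∈ 𝒜 \\ 𝒜, ∑ A : 𝒜, w A *
        ((if E ⊆ (A : Finset α) then (1 : F) else 0) + θ * (if Disjoint E (A : Finset α) then (1 : F) else 0)) = 0 from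
    H _ a b le_rfl hab hPQ
  intro n
  induction n with
  | zero =>
    intro a b hle hab _
    obtain ⟨A, hA⟩ := hab
    have h0 : (a A).natAbs + (b A).natAbs ≤ 0 :=
      le_trans (single_le_sum (f := fun A : ↥𝒜 => (a A).natAbs + (b A).natAbs) (fun _ _ => Nat.zero_le _) (mem_univ A)) hle
    omega
  | succ n ih =>
    intro a b hle hab hz
    by_cases hndvd : ∃ A, ¬ ((p : ℤ) ∣ a A) ∨ ¬ ((p : ℤ) ∣ b A)
    · -- reduce modulo p
      obtain ⟨A0, hA0⟩ := hndvd
      refine ⟨fun A => (a A : F) + (b A : F) * θ, ?_, ?_⟩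
      · intro hw
        have h0 := congr_fun hw A0
        simp only [Pi.zero_apply] at h0
        obtain ⟨h1, h2⟩ := hF _ _ h0
        rcases hA0 with h | h
        · exact h h1
        · exact h h2
      · intro E hE
        obtain ⟨h1, h2⟩ := hz E hE
        have e : ∑ A : 𝒜, ((a A : F) + (b A : F) * θ) *
            ((if E ⊆ (A : Finset α) then (1 : F) else 0) + θ * (if Disjoint E (A : Finset α) then (1 : F) else 0)) =
            ((∑ A : 𝒜, (a A * zI A E + v * (b A * yI A E)) : ℤ) : F) +
              ((∑ A : 𝒜, (a A * yI A E + b A * zI A E + u * (b A * yI A E)) : ℤ) : F) * θ := by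
          push_cast [zI, yI]
          rw [sum_mul, ← sum_add_distrib]
          refine sum_congr rfl fun A _ => ?_
          rw [quad_mul_expand hθ]
        rw [e, h1, h2]
        push_cast
        ring
    · -- all coordinates divisible by p: divide and recurse
      push Not at hndvd
      have hp0 : (p : ℤ) ≠ 0 := by exact_mod_cast (by omega : p ≠ 0)
      let a' : ↥𝒜 → ℤ := fun A => a A / p
      let b' : ↥𝒜 → ℤ := fun A => b A / p
      have ha' : ∀ A, a A = p * a' A := fun A => (Int.mul_ediv_cancel' (hndvd A).1).symm
      have hb' : ∀ A, b A = p * b' A := fun A => (Int.mul_ediv_cancel' (hndvd A).2).symm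
      obtain ⟨A0, hA0⟩ := hab
      have hA0' : a' A0 ≠ 0 ∨ b' A0 ≠ 0 := by
        rcases hA0 with h | h
        · left; intro h'; apply h; rw [ha' A0, h']; ring
        · right; intro h'; apply h; rw [hb' A0, h']; ring
      have hab' : ∃ A, a' A ≠ 0 ∨ b' A ≠ 0 := ⟨A0, hA0'⟩
      have hnat : ∀ x : ℤ, (p * x).natAbs = p * x.natAbs := fun x => by
        rw [Int.natAbs_mul]; simp
      have hle' : ∑ A : 𝒜, ((a' A).natAbs + (b' A).natAbs) ≤ n := by
        have hlt : ∑ A : 𝒜, ((a' A).natAbs + (b' A).natAbs) < ∑ A : 𝒜, ((a A).natAbs + (b A).natAbs) := by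
          apply sum_lt_sum
          · intro A _
            rw [ha' A, hb' A, hnat, hnat]
            nlinarith [Nat.zero_le (a' A).natAbs, Nat.zero_le (b' A).natAbs]
          · refine ⟨A0, mem_univ _, ?_⟩
            rw [ha' A0, hb' A0, hnat, hnat]
            have : (a' A0).natAbs ≠ 0 ∨ (b' A0).natAbs ≠ 0 := by
              rcases hA0' with h | h
              · left; exact fun h' => h (Int.natAbs_eq_zero.mp h')
              · right; exact fun h' => h (Int.natAbs_eq_zero.mp h')
            rcases this with h | h
            · have : (a' A0).natAbs < p * (a' A0).natAbs := by nlinarith [Nat.pos_of_ne_zero h]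
              nlinarith [Nat.zero_le (b' A0).natAbs]
            · have : (b' A0).natAbs < p * (b' A0).natAbs := by nlinarith [Nat.pos_of_ne_zero h]
              nlinarith [Nat.zero_le (a' A0).natAbs]
        omega
      have hz' : ∀ E ∈ 𝒜 \\ 𝒜, (∑ A : 𝒜, (a' A * zI A E + v * (b' A * yI A E)) = 0) ∧
          (∑ A : 𝒜, (a' A * yI A E + b' A * zI A E + u * (b' A * yI A E)) = 0) := by
        intro E hE
        obtain ⟨h1, h2⟩ := hz E hE
        have e1 : ∑ A : 𝒜, (a A * zI A E + v * (b A * yI A E)) = p * ∑ A : 𝒜, (a' A * zI A E + v * (b' A * yI A E)) := by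
          rw [mul_sum]; refine sum_congr rfl fun A _ => ?_; rw [ha' A, hb' A]; ring
        have e2 : ∑ A : 𝒜, (a A * yI A E + b A * zI A E + u * (b A * yI A E)) =
            p * ∑ A : 𝒜, (a' A * yI A E + b' A * zI A E + u * (b' A * yI A E)) := by
          rw [mul_sum]; refine sum_congr rfl fun A _ => ?_; rw [ha' A, hb' A]; ring
        rw [e1] at h1; rw [e2] at h2
        exact ⟨(mul_eq_zero.mp h1).resolve_left hp0, (mul_eq_zero.mp h2).resolve_left hp0⟩
      exact ih a' b' hle' hab' hz'

/-- Every element of `ℤ[t] = Algebra.adjoin ℤ {t}` is `a + b t` when `t * t = u * t + v` (`u v : ℤ`). -/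
theorem exists_int_add_int_mul_of_mem_adjoin_quad {K : Type*} [Field K] {t : K} (u v : ℤ)
    (ht : t * t = (u : K) * t + (v : K))
    {x : K} (hx : x ∈ Algebra.adjoin ℤ ({t} : Set K)) : ∃ a b : ℤ, x = (a : K) + (b : K) * t := by
  refine Algebra.adjoin_induction (p := fun x _ => ∃ a b : ℤ, x = (a : K) + (b : K) * t) ?_ ?_ ?_ ?_ hx
  · intro x hx
    rw [Set.mem_singleton_iff] at hx
    subst hx
    exact ⟨0, 1, by push_cast; ring⟩
  · intro r
    exact ⟨r, 0, by simp⟩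
  · rintro x y - - ⟨a, b, rfl⟩ ⟨c, d, rfl⟩
    exact ⟨a + c, b + d, by push_cast; ring⟩
  · rintro x y - - ⟨a, b, rfl⟩ ⟨c, d, rfl⟩
    refine ⟨a * c + v * (b * d), a * d + b * c + u * (b * d), ?_⟩
    push_cast
    linear_combination ((b : K) * d) * ht

/-- **LEMMA R_p for quadratic units.**  Let `t * t = u * t + v` in a field `K` in which `1, t` are independent over `ℤ`, and
`θ * θ = u * θ + v` in a field `F` in which `a + b θ = 0` (`a b : ℤ`) forces `p ∣ a` and `p ∣ b` (`p ≥ 2`).  If the pencil rows of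
`𝒜` at `θ` are linearly independent over `F`, then the pencil rows of `𝒜` at `t` are linearly independent over `K`. -/
theorem linearIndependent_pencil_quad_of_reduction (𝒜 : Finset (Finset α)) (u v : ℤ) {p : ℕ} (hp : 1 < p)
    {F : Type*} [Field F] {θ : F} (hθ : θ * θ = (u : F) * θ + (v : F))
    (hFp : ∀ a b : ℤ, (a : F) + (b : F) * θ = 0 → (p : ℤ) ∣ a ∧ (p : ℤ) ∣ b)
    (hF : LinearIndependent F (fun A : 𝒜 => fun E : (𝒜 \\ 𝒜 : Finset (Finset α)) =>
      (if (E : Finset α) ⊆ (A : Finset α) then (1 : F) else 0) +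
        θ * (if Disjoint (E : Finset α) (A : Finset α) then (1 : F) else 0)))
    {K : Type*} [Field K] {t : K} (ht : t * t = (u : K) * t + (v : K))
    (hK : ∀ a b : ℤ, (a : K) + (b : K) * t = 0 → a = 0 ∧ b = 0) :
    LinearIndependent K (fun A : 𝒜 => fun E : (𝒜 \\ 𝒜 : Finset (Finset α)) =>
      (if (E : Finset α) ⊆ (A : Finset α) then (1 : K) else 0) +
        t * (if Disjoint (E : Finset α) (A : Finset α) then (1 : K) else 0)) := by
  classical
  set R : Subalgebra ℤ K := Algebra.adjoin ℤ ({t} : Set K) with hR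
  have htR : t ∈ R := Algebra.subset_adjoin (Set.mem_singleton t)
  let vR : ↥𝒜 → (𝒜 \\ 𝒜 : Finset (Finset α)) → R := fun A E =>
    ⟨(if (E : Finset α) ⊆ (A : Finset α) then (1 : K) else 0) +
        t * (if Disjoint (E : Finset α) (A : Finset α) then (1 : K) else 0),
      R.add_mem (by split_ifs <;> simp [R.one_mem, R.zero_mem]) (R.mul_mem htR (by split_ifs <;> simp [R.one_mem, R.zero_mem]))⟩
  have hv : (fun A : ↥𝒜 => algebraMap R K ∘ vR A) = (fun A : 𝒜 => fun E : (𝒜 \\ 𝒜 : Finset (Finset α)) =>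
      (if (E : Finset α) ⊆ (A : Finset α) then (1 : K) else 0) +
        t * (if Disjoint (E : Finset α) (A : Finset α) then (1 : K) else 0)) := by
    funext A E
    rfl
  rw [← hv, linearIndependent_algebraMap_comp_iff]
  by_contra hdepR
  obtain ⟨g, hg, A0, hA0⟩ := Fintype.not_linearIndependent_iff.mp hdepR
  have hcoef : ∀ A : ↥𝒜, ∃ ab : ℤ × ℤ, ((g A : R) : K) = (ab.1 : K) + (ab.2 : K) * t := by
    intro A
    obtain ⟨a, b, h⟩ := exists_int_add_int_mul_of_mem_adjoin_quad u v ht (g A).2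
    exact ⟨(a, b), h⟩
  choose ab hab using hcoef
  have hne : ∃ A, (ab A).1 ≠ 0 ∨ (ab A).2 ≠ 0 := by
    refine ⟨A0, ?_⟩
    by_contra h
    push Not at h
    apply hA0
    have e : ((g A0 : R) : K) = 0 := by rw [hab A0, h.1, h.2]; simp
    exact Subtype.ext e
  have hdep : ∀ E ∈ 𝒜 \\ 𝒜, ∑ A : 𝒜, (((ab A).1 : K) + ((ab A).2 : K) * t) *
      ((if E ⊆ (A : Finset α) then (1 : K) else 0) + t * (if Disjoint E (A : Finset α) then (1 : K) else 0)) = 0 := by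
    intro E hE
    have h := congr_fun hg ⟨E, hE⟩
    simp only [Finset.sum_apply, Pi.smul_apply, smul_eq_mul, Pi.zero_apply] at h
    have h' : (((∑ i : ↥𝒜, g i * vR i ⟨E, hE⟩ : R)) : K) = 0 := by rw [h]; rfl
    have e : ∑ A : 𝒜, (((ab A).1 : K) + ((ab A).2 : K) * t) *
        ((if E ⊆ (A : Finset α) then (1 : K) else 0) + t * (if Disjoint E (A : Finset α) then (1 : K) else 0)) =
        (((∑ i : ↥𝒜, g i * vR i ⟨E, hE⟩ : R)) : K) := by
      push_cast
      refine sum_congr rfl fun A _ => ?_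
      rw [hab A]
    rw [e, h']
  obtain ⟨w, hw0, hw⟩ := exists_reduced_dependency_of_integral_dependency 𝒜 u v hp ht hK hθ hFp
    (fun A => (ab A).1) (fun A => (ab A).2) hne hdep
  rw [Fintype.linearIndependent_iff] at hF
  apply hw0
  funext A
  refine hF w ?_ A
  funext E
  simp only [Finset.sum_apply, Pi.smul_apply, smul_eq_mul, Pi.zero_apply]
  exact hw E E.2

/-- No rational golden ratio, again (local copy of `…GoldenCharTwo.int_golden_eq_zero`, to keep this file self-contained):
`p + q t = 0` with `t * t = t + 1` in characteristic `0` forces `p = q = 0`. -/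
private theorem int_eq_zero_of_golden' {K : Type*} [Field K] [CharZero K] {t : K} (ht : t * t = t + 1) (p q : ℤ)
    (h : (p : K) + (q : K) * t = 0) : p = 0 ∧ q = 0 := by
  have hp : (p : K) = -((q : K) * t) := by linear_combination h
  have e : ((p * p + p * q - q * q : ℤ) : K) = 0 := by
    push_cast
    rw [hp]
    linear_combination ((q : K) * q) * ht
  have hint : p * p + p * q - q * q = 0 := Int.cast_eq_zero.mp e
  -- parity descent
  suffices H : ∀ n : ℕ, ∀ p q : ℤ, p.natAbs ≤ n → p * p + p * q - q * q = 0 → p = 0 by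
    have hp0 : p = 0 := H _ p q le_rfl hint
    subst hp0
    refine ⟨rfl, ?_⟩
    have : q * q = 0 := by linear_combination -hint
    exact mul_self_eq_zero.mp this
  intro n
  induction n with
  | zero => intro p q hle _; omega
  | succ n ih =>
    intro p q hle h
    by_contra hp0
    have key : ∀ x y : ZMod 2, x * x + x * y - y * y = 0 → x = 0 ∧ y = 0 := by decide
    have h2 : ((p : ZMod 2)) * (p : ZMod 2) + (p : ZMod 2) * (q : ZMod 2) - (q : ZMod 2) * (q : ZMod 2) = 0 := by
      have e := congrArg (fun z : ℤ => (z : ZMod 2)) h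
      simpa using e
    obtain ⟨hp2, hq2⟩ := key _ _ h2
    obtain ⟨p', hp'⟩ := (ZMod.intCast_zmod_eq_zero_iff_dvd p 2).mp hp2
    obtain ⟨q', hq'⟩ := (ZMod.intCast_zmod_eq_zero_iff_dvd q 2).mp hq2
    subst hp' hq'
    have h' : p' * p' + p' * q' - q' * q' = 0 := by
      have e : (4 : ℤ) * (p' * p' + p' * q' - q' * q') = 0 := by linear_combination h
      rcases mul_eq_zero.mp e with e | e
      · norm_num at e
      · exact e
    have hlt : p'.natAbs ≤ n := by omega
    have := ih p' q' hlt h'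
    omega

/-- **Golden ratio, reduction modulo 3.**  Let `F` have characteristic `3` and `θ * θ = θ + 1` in `F` (so `𝔽₉ ⊆ F`, `θ ∉ 𝔽₃`);
if the pencil rows of `𝒜` at `θ` are independent over `F`, then they are independent at every `t` with `t * t = t + 1` over every
field of characteristic `0`. -/
theorem linearIndependent_pencil_golden_of_charThree (𝒜 : Finset (Finset α))
    {F : Type*} [Field F] [CharP F 3] {θ : F} (hθ : θ * θ = θ + 1)
    (hF : LinearIndependent F (fun A : 𝒜 => fun E : (𝒜 \\ 𝒜 : Finset (Finset α)) =>
      (if (E : Finset α) ⊆ (A : Finset α) then (1 : F) else 0) +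
        θ * (if Disjoint (E : Finset α) (A : Finset α) then (1 : F) else 0)))
    {K : Type*} [Field K] [CharZero K] {t : K} (ht : t * t = t + 1) :
    LinearIndependent K (fun A : 𝒜 => fun E : (𝒜 \\ 𝒜 : Finset (Finset α)) =>
      (if (E : Finset α) ⊆ (A : Finset α) then (1 : K) else 0) +
        t * (if Disjoint (E : Finset α) (A : Finset α) then (1 : K) else 0)) := by
  have three : (3 : F) = 0 := by
    have := CharP.cast_eq_zero F 3
    exact_mod_cast this
  -- residues mod 3 in F
  have cast_res : ∀ z : ℤ, ∃ r : ℤ, (r = 0 ∨ r = 1 ∨ r = -1) ∧ (z : F) = (r : F) ∧ ((3 : ℤ) ∣ z ↔ r = 0) := by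
    intro z
    have hz : z % 3 = 0 ∨ z % 3 = 1 ∨ z % 3 = 2 := by omega
    have hdiv : ((z - z % 3 : ℤ) : F) = 0 :=
      (CharP.intCast_eq_zero_iff F 3 (z - z % 3)).mpr (by exact_mod_cast (⟨z / 3, by omega⟩ : (3 : ℤ) ∣ z - z % 3))
    push_cast at hdiv
    rcases hz with h | h | h
    · refine ⟨0, Or.inl rfl, ?_, ?_⟩
      · rw [h] at hdiv; push_cast at hdiv ⊢; linear_combination hdiv
      · constructor
        · intro _; rfl
        · intro _; omega
    · refine ⟨1, Or.inr (Or.inl rfl), ?_, ?_⟩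
      · rw [h] at hdiv; push_cast at hdiv ⊢; linear_combination hdiv
      · constructor
        · intro h3; omega
        · intro h1; norm_num at h1
    · refine ⟨-1, Or.inr (Or.inr rfl), ?_, ?_⟩
      · rw [h] at hdiv; push_cast at hdiv ⊢; linear_combination hdiv + three
      · constructor
        · intro h3; omega
        · intro h1; norm_num at h1
  have hFp : ∀ a b : ℤ, (a : F) + (b : F) * θ = 0 → (3 : ℤ) ∣ a ∧ (3 : ℤ) ∣ b := by
    intro a b h
    obtain ⟨r, hr, hra, hra3⟩ := cast_res a
    obtain ⟨s, hs, hsb, hsb3⟩ := cast_res b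
    rw [hra, hsb] at h
    have hθ0 : θ ≠ 0 := by intro e; rw [e] at hθ; norm_num at hθ
    have hθ1 : θ ≠ 1 := by
      intro e; rw [e] at hθ
      have : (1 : F) = 0 := by linear_combination -hθ
      exact one_ne_zero this
    have hθ2 : θ ≠ -1 := by
      intro e; rw [e] at hθ
      have : (1 : F) = 0 := by linear_combination hθ
      exact one_ne_zero this
    rcases hr with rfl | rfl | rfl <;> rcases hs with rfl | rfl | rfl <;> push_cast at h
    · exact ⟨hra3.mpr rfl, hsb3.mpr rfl⟩
    · exact absurd (by linear_combination h) hθ0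
    · exact absurd (by linear_combination -h) hθ0
    · exact absurd (by linear_combination h : (1 : F) = 0) one_ne_zero
    · exact absurd (by linear_combination h) hθ2
    · exact absurd (by linear_combination -h) hθ1
    · norm_num at h
    · exact absurd (by linear_combination h) hθ1
    · exact absurd (by linear_combination -h) hθ2
  have hθ' : θ * θ = ((1 : ℤ) : F) * θ + ((1 : ℤ) : F) := by push_cast; linear_combination hθ
  have ht' : t * t = ((1 : ℤ) : K) * t + ((1 : ℤ) : K) := by push_cast; linear_combination ht
  exact linearIndependent_pencil_quad_of_reduction 𝒜 1 1 (p := 3) (by norm_num) hθ' hFp hF ht'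
    (fun a b h => int_eq_zero_of_golden' ht a b h)

end OrderedDifferences

end Summit.CriticalPhenomena.PercolationContinuityZ3.Theorems
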